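import Mathlib
import HarnessLib
import HarnessLib.Audit
import Summits.ResolutionOfSingularities.Statement
import Literature.AlgebraicGeometry.Motives.CartierDivisor
import Literature.AlgebraicGeometry.Resolution.LocalBlowup
import HarnessLib.Audit.Status.Attr

/-!
Route: RadicialJung

# Route RadicialJung — Jung condition rescued for height-one radicial covers — log-clean the exact
differential by blowing up the regular base, toroidal endpoint, Pialt for the rest

RESCUER route (corpses: Jung's method in char p / Giraud 1983 'condition de Jung pour les
revêtements radiciels de hauteur 1' +
Giraud1983 'forme normale d'une fonction', stalled in base dimension ≥ 4; Moh 1987 Stability,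
refuted by HauserPerlega2019 for
height e ≥ 3 but VALID at e = 1). It suffices to show X = CleanModels ∧ Pialt ∧ CleanModelsSuffice.
CleanModels (the DODGE, rank 2): for
every regular integral separated finite-type W over a field k of char p and every purely inseparable
extension L/K(W) of degree p,
some proper birational REGULAR V → W carries, at EVERY point v, a generator y of L/K(W) whose p-th
power g is LOG-CLEAN at v — either
g = ∏_{i<m} t_i^{a_i} with (t_1..t_d) a minimal generating system of m_v of length d = dim O_{V,v},
m ≥ 1 and all a_i prime to p
(toroidal type), or g = u₀ a unit at v which is residually not a p-th power or differs from a p-th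
power by a regular parameter
(regular type). Pialt (rank 3, = pAlteration stmt-0555 verbatim): purely inseparable regular
alterations exist. CleanModelsSuffice
(rank 4, NEW rev 2 — the consumed crux, per prime and summit-concluding): for every prime p, PIAlt_p
→ CleanModels_p → ResolutionInChar p,
the two antecedents being the bodies of Pialt and CleanModels at p VERBATIM. Its only unproved
content is the rev-1 crux CleanResolves —
a log-clean model resolves the normalisation of W in L — kept as a SUPPORT item (re-badged rev 2);
the rest is pAlteration's PROVED
per-prime frame (Theorems.palterationThesisAt_iff_resolutionInChar: PIAlt_p ∧ PICover_p ↔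
ResolutionInChar p; the degree-p tower
Theorems.Picover.OfDegP.hasResolution_normalizationIn_of_finrank_eq_pow +
Picover.OfNormalizationIn.stub_ofNormalizationIn:
PicoverDegP_p ⟹ PICover_p), and the planner probe sketch/Probe.lean (rc 0, axioms
propext/Classical.choice/Quot.sound) proves
CleanResolves ⊢ CleanModelsSuffice from those theorems ALONE, so the fold adds nothing unproved.
`closes` is pure logic over the
three cruxes and the route file imports NO Theorems module and NO Literature module carrying an
unproved fact (rev 1 cone repair kept;
rev 2 glue repair: the rev-1 deciding theorem took the proved-in-tree SUPPORT PialtPicoverDegPFrame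
as a hypothesis — gate stamp
glue.non-crux-hypothesis — and proving that frame INSIDE `closes` would import
Theorems.PAlterationPalterationThesisIffSummit, whose
module cone carries 41 unproved named facts, so the frame now lives inside the crux
CleanModelsSuffice, exactly as the sibling
WildQuotients' SummitReduction). Card realised: clean-differential (spine; its inseparable half,
recut).
Lean: `CleanModels ∧ Pialt ∧ CleanModelsSuffice`

## Assembly
Pure logic, certified (sketch/Sketch.lean = the rev-2 file with kinds in the tags: lean check rc 0,
0 sorries, `closes` axioms
propext/Classical.choice/Quot.sound, native #h21_check_closes ok, codes [], non_crux [], hypotheses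
= the three cruxes; #h21_route_deps
16 constants, none unproved): `closes hC hP hS := ResolutionOfSingularities_iff.mpr fun p hp => hS p
hp (hP p hp) (hC p hp)` —
CleanModelsSuffice's two antecedents are Pialt and CleanModels with the prime fixed, verbatim, and
ResolutionOfSingularities_iff
(Statement file) folds `∀ p, ResolutionInChar p` back into the summit. The Assembly item is the same
3-chain
CleanModels → Pialt → CleanModelsSuffice → ResolutionOfSingularities (rev 2; the rev-1 4-chain
through PialtPicoverDegPFrame is
retired with that support, which no item needs any more — it stays true and provable in three lines
from
Theorems.palterationThesis_iff_pialt_and_picoverDegP, but is not part of the argument).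

Rationale: WHY THIS LINE. Jung's method dies in characteristic p above a normal-crossings branch locus (wild
local fundamental groups; Kollar2007 2.57), and for
a height-one radicial cover t^p = g of a regular W there is no branch locus at all: Giraud's
replacement (Giraud1983Jung,
Giraud1983; Cossart's 1987 thèse in base dimension 3; Posva2024 Thm 1 for 1-foliations in dim ≤ 3)
is the JUNG CONDITION on the
exact differential dg — make the K(W)^p-line of g log-clean by blowing up the BASE, after which the
cover is toroidal (a quotient of a
regular scheme by μ_p^{m-1}) and toric geometry finishes (Kato1994 (10.4), Niziol2006 5.8, in tree
as
Literature.AlgebraicGeometry.Resolution.Kato1994_logRegular_hasResolution). The programme stalled in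
base dimension ≥ 4 and the
Moh/Hauser residual-order engine that might have driven it is false from height 3 on
(HauserPerlega2019 §3-4); the rescue is (i)
HEIGHT ONE ONLY — HP §3 print that Moh's bound 'is known to be valid for e = 1', and the tree
already reduces the whole summit to
degree-p residues (Theorems.palterationThesis_iff_pialt_and_picoverDegP: summit ⟺ Pialt ∧
PicoverDegP, and prime by prime Theorems.palterationThesisAt_iff_resolutionInChar + the degree-p
tower Theorems.Picover.OfDegP — the proved frame folded into the crux CleanModelsSuffice; the tower
is
normalised at every step, so HP's e = 3 monsters dissolve into three e = 1 problems over changing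
regular bases), (ii) the honest
LOG-clean endpoint (making ker dg a subbundle is false already on surfaces: multiplicative points
persist, z^5 = xy cycles mod 5 —
computed by the opener), (iii) a GLOBAL, base-only, all-dimension statement typed pointwise with the
three cases that imperfect residue
fields force. Imported: Kato/Abbes–Saito cleanliness and log geometry (the differential dg = the
refined conductor of the μ_p/α_p-torsor
is insensitive to the p-th-power ambiguity that creates kangaroo points: d(c^p) = 0),
Jacobson–Ekedahl foliation quotients
(multiplicative = toroidal; RudakovShafarevich/Hirokado), toric resolution. No open route has this
lever: pAlteration files the class
statement Picover with no engine, Valuative/CyclicCovers uniformize along valuations and must patch,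
CleanCovers cleans the
SEPARABLE-wild residue of étale covers of A^n (Kedlaya), WeightedInvariant posits an invariant,
WildQuotients takes quotients.

RANKED CRUXES. #2 CleanModels (crux) — LOG-CLEAN MODELS EXIST (the dodge; card clean-differential
CleanDescent_n recut globally and at height one): for p prime, k any field of char p, W regular
integral separated finite type over k, L/K(W) purely inseparable of degree p, there are an integral
V and a proper birational dominant π : V → W with V regular such that at every v ∈ V some y ∈ L ∖
K(W) has y^p = g ∈ K(W) with π^*g either = ∏_{i<m} t_i^{a_i} for a minimal generating system
(t_1..t_d) of m_v, d = dim O_{V,v}, 1 ≤ m, p ∤ a_i (toroidal type), or = a unit u₀ of O_{V,v} with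
(∀ c, u₀ − c^p ∉ m_v) ∨ (∃ c, u₀ − c^p ∈ m_v ∖ m_v²) (regular type). Unchanged from rev 0.
[difficulty: open-problem] (why it might fail: it implies PicoverDegP (open, dim ≥ 4) and is
stronger (base-only, Zariski-snc): the zero scheme of dg may hide in p-th-power directions after
blow-up like a residual order; Giraud n=2 and Cossart n=3 clean in COMPLETIONS, algebraic t_i may
cost extra blow-ups or fail at non-closed points.) [Giraud1983Jung, Giraud1983, Posva2024,
HauserPerlega2019, Moh1987, AbbesSaito2011, CossartPiltant2019, Temkin2013]
ATTACK ON #2 (rev 7, judge-repair 2026-08-17: 'a stated and stubbed first lemma for cleaning dg on a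
regular 4-fold along one valuation'). Technique: ZARISKI'S ARCHITECTURE FOR THE EXACT FORM dg —
clean along ONE valuation, then patch. Along a valuation ring O of K(W) centred on W the centre is
ONE regular local ring and L = K(g^{1/p}) extends O uniquely with e·f·δ = p, which sorts the work:
Abhyankar places are monomialised (KnafKuhlmann2005 Thm 1.1; in tree KnafKuhlmann2005_Thm11) leaving
the unit step (≤ p−1 blow-ups per multiplicative point in dim 2: Cruxes/CleanModels/Disproof.lean
(Z1)–(Z3)); immediate/defect rank-one places are where Giraud's height-one residual-order game is
played and HauserPerlega2019 §3 print Moh's bound VALID; rank > 1 by composite valuations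
(NovacoskiSpivakovsky2014 rank-one reduction, re-proved for 'clean'). It bites on 'W regular' (dg
lives in the free Ω¹ of a regular local ring) and 'degree p' (height one, unique extension). FIRST
LEMMA, STATED: support item #9 CleanAlongValuation4 (stmt-ResolutionOfSingularities-18006, below) =
the local statement at centres of dimension ≤ 4, in the Valuative/LocalBlowup idiom. STUBBED:
planner skeleton line-valuative-clean.lean (evidence on stmt-15917/18006: stub_cleanAlongValuation4
:= the item by name, stub_cleanAlongValuationHigh = centres of dim > 4, stub_cleanPatching = local ⟹
CleanModels ⊢ CleanModels_of, lean check rc 0, sorries = the 3 stubs) + APPROACH card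
valuative-clean-dim4 (evidence on stmt-15917). The lead's registered line Lines/Sketch.lean rev 6
(formal principalization at closed points → algebraized boundary) is untouched; the two cuts meet in
dim 2 at (Z1)–(Z3).
#3 Pialt (crux) — Abramovich–Oort / Temkin2013 Conj. 1.3.1 (pAlteration stmt-0555 VERBATIM, shared
by dedup; also WildQuotients' target): every integral separated finite-type scheme over a field of
characteristic p admits a purely inseparable regular alteration. Inherited, never the cause of death
of the Jung/Giraud/Moh programmes; it is the price of the tree's reduction summit ⟺ Pialt ∧
PicoverDegP, consumed per prime by CleanModelsSuffice. Unchanged. [difficulty: open-problem] (why it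
might fail: open since AbramovichOort2000 Q 2.13; Temkin2013 Thm 1.3.3 gives only a finite Zariski
COVER by inseparably uniformized pieces — patching them into ONE alteration is unsolved; a 4-fold
with no p.i. regular alteration kills this route and pAlteration/WildQuotients together.)
[Temkin2013, AbramovichOort2000, DeJong1997, Temkin2017]
#4 CleanModelsSuffice (crux, NEW rev 2 — the consumed crux, per prime and summit-concluding;
replaces CleanResolves as a `closes` hypothesis) — LOG-CLEAN MODELS SUFFICE IN CHARACTERISTIC p: ∀ p
prime, PIAlt_p (the body of Pialt at p, verbatim) → CleanModels_p (the body of CleanModels at p,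
verbatim) → ResolutionInChar p. Content: (1) the support CleanResolves — a log-clean model (V, π) of
(W, L) resolves the normalisation of W in L (toroidal-type points give Kato-log-regular charts Spec
O_{V,v} ⊗_{Z[P]} Z[P^sat], P = ⟨e_0..e_m | p e_0 = Σ a_i e_i⟩, regular-type points are regular;
Kato1994 (10.4) / Niziol2006 5.8, gluing, transport along V^L → W^L) — the ONLY unproved content;
(2) PicoverDegP_p by pure logic from CleanModels_p + (1); (3) pAlteration's PROVED per-prime frame:
PicoverDegP_p ⟹ PICover_p by the degree-p tower
(Theorems.Picover.OfDegP.hasResolution_normalizationIn_of_finrank_eq_pow +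
OfNormalizationIn.stub_ofNormalizationIn + FunctionFieldRadicial.stub_functionFieldRadicial,
Temkin2013 Rem 1.3.5 (ii)) and PIAlt_p ∧ PICover_p ⟹ ResolutionInChar p
(Theorems.palterationThesisAt_iff_resolutionInChar p: level models + relative Frobenius, reduced →
integral). Planner probe sketch/Probe.lean rc 0, axioms propext/Classical.choice/Quot.sound:
`CleanResolves → CleanModelsSuffice` by those theorems ALONE, so the fold adds nothing unproved; the
prover's Theorems file may import those modules (proved cone) — only the ROUTE file stays
import-clean. [deps: CleanModels, Pialt; support CleanResolves] [difficulty: L] (why it might fail: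
its open content CleanResolves — the pointwise toric charts of a log-clean V need not glue to ONE
Zariski log structure on V^L (a ramified divisor can cross a clean point off its toric boundary:
z²=x³ at t²=x), so Kato's global fan may not exist; only-as-typed risks otherwise.) [Kato1994,
Niziol2006, BerghRydh2019, Giraud1983Jung, Liu2002, Temkin2013,
Theorems.palterationThesisAt_iff_resolutionInChar,
Theorems.Picover.OfDegP.hasResolution_normalizationIn_of_finrank_eq_pow]
#9 CleanResolves (support since rev 2; was crux #4) — A LOG-CLEAN MODEL RESOLVES THE RESIDUE (the
open content of CleanModelsSuffice, stated on its own; a prover of that crux lands it first,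
--supports): with W, L as above and (V, π) as produced by CleanModels (V integral regular, π proper
birational dominant, pointwise log-clean), the normalisation of W in L has a resolution. RESTATED
rev 1 (cone repair) with `Literature…normalizationIn W L` UNFOLDED to Mathlib — the relative
normalisation `(Spec.map (K(W) → L) ≫ W.fromSpecStalk (genericPoint W)).normalization` of Spec L → W
— definitionally the rev-0 statement (Iff.rfl, probe/ProbeFrame2.lean), so that the route file no
longer imports NormalizationInExtension (whose cone carries DeJong1996Projective and
AbramovichOortConjecture); provers import NormalizationInExtension in their Theorems file and `show
… normalizationIn W L` to use its API (isFinite_normalizationInι, isAlteration_normalizationInι).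
Plan: at a toroidal-type point V^L is Zariski-locally Spec of O_{V,v} ⊗_{Z[P]} Z[P^sat], P =
⟨e_0..e_m | p e_0 = Σ a_i e_i⟩, log-regular in Kato's sense; at a regular-type point V^L is regular;
resolve by Kato1994_logRegular_hasResolution / canonical toric subdivision glued along strata, then
transport along V^L → W^L (proper birational). [deps: CleanModels] [difficulty: L] (why it might
fail: the pointwise toric charts need not assemble into ONE Zariski log structure on V^L (a ramified
divisor can cross a clean point off its toric boundary: z²=x³ at t²=x), so Kato's global fan may not
exist; gluing local toric resolutions needs a canonical subdivision or destackification.) [Kato1994,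
Niziol2006, BerghRydh2019, Giraud1983Jung, Liu2002]
#9 CleanAlongValuation4 (support, NEW rev 7 — the FIRST LEMMA of the attack on #2) — LOG-CLEANING
ALONG ONE VALUATION, CENTRE OF DIMENSION ≤ 4: k ⊆ K fields of char p, A₀ ⊆ K a finitely generated
k-subalgebra with Frac A₀ = K (an affine model of W), O a valuation ring of K containing A₀ whose
centre R₀ = locAtCentre A₀ O is regular of dimension ≤ 4, g ∈ K ∖ K^p; then some finitely generated
A with A₀ ⊆ A ⊆ O (= a finite tower of LOCAL BLOW-UPS of R₀ along O, lu_tower_iff_fg) has regular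
centre R = locAtCentre A O at which a non-trivial representative Σ c_j^p g^j of the K^p-line of g is
loosely log-clean (u·∏ t_i^{a_i} with (t_i) a regular system of parameters, u ∈ R^×, m ≥ 1, p ∤ a_i;
or a unit residually not a p-th power; or c^p + a regular parameter). A CONSEQUENCE of CleanModels
(centre of O on the clean model by the valuative criterion + an affine chart; regularity analogue
proved in tree, ResolutionLU.exists_affineModel_regular_of_hasResolution); in print for dim ≤ 2
(Giraud1983), dim 3 over k̄ (Cossart 1987 / CossartPiltant2008-2009), Abhyankar places in all
dimensions up to the unit step (KnafKuhlmann2005); OPEN at dim 4, where it is strictly weaker than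
CleanModels and than embedded LU of t^p = g in a regular 5-fold (CutkoskyMourtada2019). Bridge: a
clean centre gives Valuative.LuAlphaPTorsor (stmt-0641) at that valuation (toric local blow-ups of
the μ_p-quotient); the item is the base-side endpoint of Valuative's live line
pfaff-line-log-final-forms (frontier stub_nonAbhyankarCore = this item's hard case). [deps:
CleanModels] [difficulty: open-problem at dim 4; dim ≤ 1 and Abhyankar places provable now] (why it
might fail: dim-4 centre + DEFECT valuation of rank 1 / rational rank 1: the order of the best
representative mod p-th powers can jump at kangaroo points of the centre sequence; no bound known in
dim 4 even along one valuation.) [Giraud1983, CossartPiltant2008, KnafKuhlmann2005,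
NovacoskiSpivakovsky2014, CutkoskyMourtada2019, HauserPerlega2019]
(Dropped rev 2: the rev-1 support PialtPicoverDegPFrame = the PROVED global frame Pialt ∧
PicoverDegP ⇒ summit — true and closable in three lines from
Theorems.palterationThesis_iff_pialt_and_picoverDegP +
palterationThesis_iff_resolutionOfSingularities, but as a SUPPORT it may not be a hypothesis of
`closes` (gate stamp glue.non-crux-hypothesis) and proving it inside `closes` would import a
Theorems module whose import cone carries 41 unproved named facts; its per-prime form now lives
inside CleanModelsSuffice.)

TWO-LAYER PLAN. Foreseen glued splits (nothing filed now): (rev 7) CleanModels ⇐ CleanAlongValuation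
(#9 CleanAlongValuation4 in ALL dimensions, every valuation) → CleanPatching (quasi-compact RZ(W),
in tree ZariskiRiemannSpace.compactSpace, + Zariski–Piltant patching of finitely many clean charts;
open as an implication in dim ≥ 4 like Valuative.PatchingRel) → CleanModels — skeleton
line-valuative-clean.lean; alternatively CleanModels ⇐ CleanCodimOne → CleanInduct → CleanModels,
where CleanCodimOne = log-clean
models exist over an open containing all codimension-≤1 points of W (DVR cleaning terminates because
divisorial = Abhyankar places are
defectless: g ∉ (Ô_E)^p) and CleanInduct = Noetherian induction on the closed non-clean locus Z(dg)
with an integer conductor-type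
measure (card clean-differential's ConductorDrops: total dimension / torsion length of Ω¹(log)/θ).
CleanModelsSuffice ⇐ CleanResolves (support, the content) + DegPFrame_p (pAlteration's proved
per-prime frame, `--glue-by` a Theorems lemma) if a tenure planner wants the content staffed on its
own; CleanResolves ⇐ CleanChart (local
algebra: clean ⟹ V^L ≅ Spec O ⊗_{Z[P]} Z[P^sat] log-regular, resp. regular) → ChartsGlue (canonical
toric resolution of the μ_p^{m-1}
quotient singularities glues; or destackification) → CleanResolves. Calibration supports provers may
attach with --supports: CleanModels
for dim W = 1 (trivial), dim W = 2 (Giraud1983 = the theorem this line generalises), dim W = 3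
(Cossart 1987 / CossartPiltant2008-9).

KILL CRITERIA. ¬CleanModels for some p (a regular W, typically a 4-fold, and a degree-p L with NO
log-clean regular model) closes the route
(refuted:CleanModels) — note it would not refute the summit, CleanModels being stronger than
PicoverDegP; if the counterexample only
defeats the Zariski-snc (algebraic t_i) demand while a henselian/étale-clean model exists, pivot
once: restate with étale-local charts.
¬Pialt closes this route together with pAlteration and WildQuotients (then the residue engine
CleanModels ∧ CleanResolves is re-homed
under Valuative's TorsorToLurel/PatchingRel, where it yields LuAlphaPTorsor for free). PicoverDegP
proved elsewhere by another engine
makes CleanModels moot but not false (close superseded). ¬CleanModelsSuffice with CleanModels and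
Pialt standing can only come from its open content: ¬CleanResolves (a clean model whose
normalisation is not resolvable) would be
a theorem against Kato (10.4) — expect instead a MISSTATED verdict on the gluing clause, repaired by
adding a global-boundary rider to
CleanModels (new items CleanModelsR / CleanModelsSufficeR, re-certified glue); the frame part of
CleanModelsSuffice is proved in tree (sketch/Probe.lean rc 0), so a
refutation of it alone would be a kernel inconsistency, not a verdict on the line.

NOT DECOMPOSED YET. The terminating measure for CleanModels in dim ≥ 4 (conductor / total dimension
of vanishing cycles / torsion length — the card's
ConductorDrops) is deliberately NOT an item: it is the content of the crux and any specific integer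
invariant filed now would be a
hand-picked target for a Hauser–Perlega-type cycle. The transport normalizationIn V L →
normalizationIn W L (proper birational along
birational π) and 'IsBirational ⟹ functionFieldMap bijective' are prover-level lemmas (--supports
CleanResolves), not items. Imperfect
ground fields are INSIDE the statements (k arbitrary), so no Descent item is needed; reduced →
integral, normalisation, the Frobenius
sandwich and the radicial degree-p tower are all discharged inside pAlteration's proved per-prime
frame, which rides INSIDE the crux
CleanModelsSuffice (rev 2; script = sketch/Probe.lean of the repair planner) rather than being
imported by this file, to keep the route module's import
cone free of unproved Literature facts (rev 1 cone repair, D-0023 guardrail: the rev-0 imports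
Theorems.PAlterationPalterationThesisIffSummit
and Literature…NormalizationInExtension dragged in 41 unproved facts — AbramovichOortConjecture,
Temkin2013, BGMW2011(_canonical),
Stacks081R, 26 DeJong1996* induction facts, 7 CossartPiltant2019*/CossartJannsenSaito2020* — none of
which any item uses; CONE HYGIENE
wanted from librarians, as already asked by WildQuotient rev 1: move AbramovichOortConjecture out of
Alterations.lean into a leaf file and
decouple NormalizationOfVarieties/NormalizationInExtension from Alterations/AlterationsProofs, which
would also clean pAlteration, Descent
and UniformComplexity).

CHEAPEST FALSIFIER. (a) Specialise CleanModels to dim W = 2 over an algebraically closed field: it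
must be Giraud's theorem (Giraud1983, normal form
u = v^p + x^a / unit cases after point blow-ups) — a lookup, consistent. (b) Run the catalogued
specimens by hand (done by the opener,
re-deriving card clean-differential §Why (3)): Hauser's kangaroo surface x² + y⁷ + yz⁴ (p = 2): g =
y(y³+z²)² ~ y is clean with ZERO
blow-ups (normalisation = A²); CossartPiltant2019 Rem 3.2, Z^p + u₄u₁^p + u₃u₂^p: dg = u₁^p du₄ +
u₂^p du₃ vanishes on {u₁ = u₂ = 0},
one blow-up of that regular centre gives g = u₁^p(u₄ + v^p u₃) ~ u₄ + v^p u₃, a regular parameter: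
clean (regular type after the
shift, toroidal type m = 1). (c) The cheapest REAL attack: take HauserPerlega2019's second family (p
≥ 3, n = 4, e = 3), pass to the
first floor of its degree-p tower (g = F, height one over A⁴) and compute the zero scheme of dg
along HP's point-blow-up cycle: if
Z(dg) reproduces the divergent residual orders under EVERY choice of regular centre inside Z(dg),
CleanModels-by-blowing-up-Z(dg) is
dead in dim 4 (the statement could survive, the engine would not).

NUMBERS. Known cases of CleanModels: base dimension 1 (DVR cleaning; defectless divisorial places),
2 (Giraud1983; Posva2024 Thm 1 surfaces),
3 (Cossart 1987 thèse d'état, the input of CossartPiltant2008/2009's hypersurface case; Posva2024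
threefolds). Open: dim W ≥ 4, every
p — exactly Literature.Barriers.ResolutionOfSingularities.DimensionFourFrontier. Moh's one-step
bound at height e: p^{e-1}
(KangarooShadeIncrease.lean); stability valid e = 1, false e ≥ 3 (ResidualOrderUnbounded.lean, HP
families p = 2, n = 5 and p ≥ 3,
n = 4), height two undecided in print (card moh-fails-at-height-two-recharge-budget computes a 3 → 7
rise for z^9 + F, p = 3, n = 4).
Cone (rev 1, kept rev 2): route-file imports Mathlib, HarnessLib,
Summits.ResolutionOfSingularities.Statement, Literature.AlgebraicGeometry.Motives.CartierDivisor
(Mathlib-only) — 2 imports dropped, 0 of the 41 listed facts genuinely needed; gate deps 16 project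
constants, 0 unproved (ResolutionInChar exempt, summit-grade).
Items (rev 7): cruxes 3 (CleanModels r2, Pialt r3, CleanModelsSuffice r4), supports 2
(CleanResolves; CleanAlongValuation4 = the first lemma of the attack on CleanModels, stmt-18006),
assembly 1 — 6 items; `closes` hypotheses = the 3 cruxes (unchanged). Imports rev 7: +
Literature.AlgebraicGeometry.Resolution.LocalBlowup (Mathlib + HarnessLib only; gate deps 17 project
constants, 0 unproved).

DEFINITION REQUESTS. None required to type the items (cleanliness is inlined pointwise over
Mathlib's stalks / IsLocalRing.maximalIdeal / ringKrullDim and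
the tree's RatFn.functionFieldMap; the normalisation of W in L is Mathlib's
`Scheme.Hom.normalization` of Spec L → Spec K(W) → W, i.e.
Literature…normalizationIn unfolded). Nice-to-have (not filed): a Literature notion `LogCleanAt p v
g` factoring the inlined predicate; a
vendored Nizioł 2006 Thm 5.8 for ÉTALE log structures (Kato1994_logRegular_hasResolution is the
one-Zariski-chart case); cone hygiene of
Literature/AlgebraicGeometry/Resolution (see Not decomposed yet) so that `normalizationIn` and its
API become importable by route files again.

Novelty: Searches (2026-08-16): `lit search --source zbmath` ×9 ("Giraud condition de Jung revetements
radiciels" → doi:10.1007/bfb0099969;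
"Giraud forme normale fonction" → doi:10.24033/bsmf.1980; "Urabe resolution arbitrary
characteristic" → arXiv:1004.5446/1011.1083 +
WITHDRAWN math/0006071; "purely inseparable cover toroidal resolution blow-up differential form" 0
hits; "p-closed foliation reduction
singularities positive characteristic" 0; "1-foliations resolution Posva" → arXiv:2405.05735;
"Cossart forme normale dimension trois" 0);
`lit galaxy search --star all` ("revêtements radiciels de hauteur un" → Cano LNM 1259 citing Giraud;
"purely inseparable covering" →
Blass 'Zariski surfaces and differential equations in char p', Miyanishi–Ito, CJS LNM 2270); `lit
frontier ResolutionOfSingularities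
--since 2023` (30 rows; nearest arXiv:2602.06553 ranking-function search, arXiv:2004.11004 valuation
rings as lci limits — none on
radicial covers); local `lit search` tier DOWN (ConnectionResetError, logged); `ledger negatives`
(0); all 10 route headers; 185 card
titles + greps (Giraud ×20 cards, clean ×30): nearest = card clean-differential and the LOCAL line
pfaff-line-log-final-forms on
Valuative.LuAlphaPTorsor.
Nearest prior art found: Giraud1983Jung + Giraud1983 (the lever, base dimension 2); Posva2024 (dim ≤
3, foliation language);
HauserPerlega2019 §3 (e = 1 validity of Moh1987); card clean-differential (2026-08-15, un-routed:
both AS and p.i. halves, conductor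
invariant, assembly  [refs: 10.1007/bfb0099969, 10.24033/bsmf.1980, 1004.5446, 2405.05735, 2602.06553, 2004.11004, doi:10.1007/bfb0099969, doi:10.24033/bsmf.1980, Giraud1983, Posva2024, HauserPerlega2019, Moh1987]

Barriers (technique_class: kato-cleanliness, dlog-normal-form, toroidal, rescuer): - technique_class: kato-cleanliness, dlog-normal-form, toroidal, rescuer
- Literature.Barriers.ResolutionOfSingularities.DimensionFourFrontier: it does not evade it; the bet
is that the missing fourth step is easier for the exact 1-form dg on the REGULAR 4-fold W (codim-≥2
zero scheme, integer ramification invariants, no embedded resolution one dimension down as input)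
than for the hypersurface t^p = g in a 5-dimensional ambient space.
- Literature.Barriers.ResolutionOfSingularities.Hauser2003_kangarooShadeIncrease: evaded at the
level of the OBJECT — dg kills p-th powers (d(c^p) = 0), so no cleaning choice, no residual order
and no shade is ever formed; Hauser's kangaroo surface is clean with zero blow-ups. Honest residue:
ord Z(dg) may still stagnate (why-might-fail of CleanModels).
- Literature.Barriers.ResolutionOfSingularities.hauserPerlega_mohProofBoundFails: evaded by HEIGHT —
the refuted Stability Theorem is e ≥ 3; the route works at e = 1 only, where HP print Moh's bound
valid, and reaches every height through the normalised degree-p tower (proved: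
picover_iff_picoverDegP).
- Literature.Barriers.ResolutionOfSingularities.Narasimhan1983_noSmoothHypersurfaceThroughTopLocus:
not met — no hypersurface of maximal contact, no coefficient ideal; centres are regular strata of
the zero scheme of a 1-form on the regular base.
- Literature.Barriers.ResolutionOfSingularities.DirectrixSmallCharacteristicNarrow: not met — no
directrix / Hilbert–Samuel stratification is used; but i

History (route lifecycle, newest last):
- 2026-08-16T16:30:56Z · rev 1: restated CleanResolves (stmt-ResolutionOfSingularities-15918), Assembly (stmt-ResolutionOfSingularities-15919) — cone repair (rrepair, D-0023 guardrail): the rev-0 import cone carried 41 unproved Literature facts (AbramovichOortConjecture, Temkin2013, BGMW2011, Stacks081R, (planner-rrepair-ResolutionOfSingularities-Radi-32f2f141-0)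
- 2026-08-16T16:53:15Z · rev 5: restated Assembly (stmt-ResolutionOfSingularities-16287) — rev 2 glue repair, tidy-up: Assembly restated to the crux-only 3-chain that `closes` proves (the rev-1 4-chain went through the support PialtPicoverDegPFrame, w (planner-rrepair-ResolutionOfSingularities-Radi-32f2f141-g2-0)
- 2026-08-16T16:54:19Z · rev 6: dropped PialtPicoverDegPFrame — rev 2 glue repair, final tidy-up: drop the rev-1 support PialtPicoverDegPFrame (stmt-16288; not load-bearing any more — `closes` is the crux-only 3-chain CleanM (planner-rrepair-ResolutionOfSingularities-Radi-32f2f141-g2-0)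
- 2026-08-24T04:24:21Z · DORMANT — reconciler: no traction for 6.5 d (last activity item-evidence-added at 2026-08-17T15:02:59Z); parked, not closed — `ledger route dormant route-ResolutionOfSing (operator:999:1104637)
- 2026-08-27T15:45:53Z · REACTIVATED — reconciler: reactivated — activity item-proof-filed at 2026-08-27T13:40:56Z after parking at 2026-08-24T04:24:21Z (operator:999:270425)

sub-problem: ResolutionOfSingularities · status: open · opened planner-plan-lens-ResolutionOfSingularities-rescuer-v2-0 2026-08-16T16:05:47Z · rev 8 · ledger route-ResolutionOfSingularities-RadicialJung
GENERATED by the gate from the ledger (D-0016/17). Provers cite these decls: `theorem foo : Summit.ResolutionOfSingularities.ResolutionOfSingularities.Theses.RadicialJung.<Decl> := …` in Summits/ResolutionOfSingularities/ResolutionOfSingularities/Theorems/<Name>.lean.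
-/

namespace Summit.ResolutionOfSingularities.ResolutionOfSingularities.Theses.RadicialJung

open scoped BigOperators Topology Manifold Classical MeasureTheory ProbabilityTheory Matrix InnerProductSpace ComplexConjugate ContinuousMap
open Filter Set Function TopologicalSpace MeasureTheory

attribute [summit_statement] _root_.ResolutionOfSingularities

/-- item stmt-ResolutionOfSingularities-15917 · crux · rank 2 · open · by planner
why it might fail: it implies PicoverDegP (open, dim ≥ 4) and is stronger (base-only, Zariski-snc): the zero scheme of dg may hide in p-th-power directions after blow-up like a residual order; Giraud n=2 and Cossart n=3 clean in COMPLETIONS, algebraic t_i may cost extra blow-ups or fail at non-closed points.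
sources: Giraud1983Jung, Giraud1983, Posva2024, HauserPerlega2019, Moh1987, AbbesSaito2011
[crux] LOG-CLEAN MODELS EXIST (the dodge; card clean-differential CleanDescent_n recut globally and
at height one): for p prime, k any field of char p, W regular integral separated finite type over k,
L/K(W) purely inseparable of degree p, there are an integral V and a proper birational dominant π :
V → W with V regular such that at every v ∈ V some y ∈ L ∖ K(W) has y^p = g ∈ K(W) with π^*g either
= ∏_{i<m} t_i^{a_i} for a minimal generating system (t_1..t_d) of m_v, d = dim O_{V,v}, 1 ≤ m, p ∤
a_i (toroidal type), or = a unit u₀ of O_{V,v} with (∀ c, u₀ − c^p ∉ m_v) ∨ (∃ c, u₀ − c^p ∈ m_v ∖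
m_v²) (regular type). [difficulty: open-problem] -/
@[route_item "route-ResolutionOfSingularities-RadicialJung", crux (bottleneck := idea) (experiment := "instrument: ERIMENT-FIRST (D-0160/D-0181(3)): one instrument cell on the dim-4 purely-inseparable point (extend PI4's two-engine K-certified census to …") (source := "director HOURLY-RESOLUTION l.1136 + director RESOLUTION l.104, 2026-09-01")]
def CleanModels : Prop :=
  ∀ p : ℕ, p.Prime → ∀ (k : Type) [Field k] [CharP k p] (W : AlgebraicGeometry.Scheme.{0}) [AlgebraicGeometry.IsIntegral W] (f : W ⟶ AlgebraicGeometry.Spec (.of k)) (L : Type) [Field L] [Algebra W.functionField L], AlgebraicGeometry.IsSeparated f → AlgebraicGeometry.LocallyOfFiniteType f → AlgebraicGeometry.QuasiCompact f → Literature.AlgebraicGeometry.Resolution.Scheme.IsRegular W → IsPurelyInseparable W.functionField L → Module.finrank W.functionField L = p → ∃ (V : AlgebraicGeometry.Scheme.{0}) (π : V ⟶ W) (_ : AlgebraicGeometry.IsIntegral V) (_ : AlgebraicGeometry.IsDominant π), AlgebraicGeometry.IsProper π ∧ Literature.AlgebraicGeometry.Resolution.IsBirational π ∧ Literature.AlgebraicGeometry.Resolution.Scheme.IsRegular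 V ∧ (∀ v : V, (∃ (y : L) (g : W.functionField), y ∉ Set.range (algebraMap W.functionField L) ∧ algebraMap W.functionField L g = y ^ p ∧ ((∃ (d m : ℕ) (hmd : m ≤ d) (t : Fin d → V.presheaf.stalk v) (a : Fin m → ℕ), Ideal.span (Set.range t) = IsLocalRing.maximalIdeal (V.presheaf.stalk v) ∧ ringKrullDim (V.presheaf.stalk v) = (d : WithBot ℕ∞) ∧ 0 < m ∧ (∀ i, ¬ p ∣ a i) ∧ Literature.AlgebraicGeometry.Motives.RatFn.functionFieldMap π g = ∏ i : Fin m, (algebraMap (V.presheaf.stalk v) V.functionField (t (Fin.castLE hmd i))) ^ (a i)) ∨ (∃ u₀ : V.presheaf.stalk v, IsUnit u₀ ∧ Literature.AlgebraicGeometry.Motives.RatFn.functionFieldMap π g = algebraMap (V.presheaf.stalk v) V.functionField u₀ ∧ ((∀ c : V.presheaf.stalk v, u₀ - c ^ p ∉ IsLocalRing.maximalIdeal (V.presheaf.stalk v)) ∨ (∃ c : V.presheaf.stalk v, u₀ - c ^ p ∈ IsLocalRing.maximalIdeal (V.presheaf.stalk v) ∧ u₀ - c ^ p ∉ IsLocalRing.maximalIdeal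 (V.presheaf.stalk v) ^ 2))))))

/-- item stmt-ResolutionOfSingularities-0555 · crux · rank 3 · open · by planner
why it might fail: open since AbramovichOort2000 Q 2.13; Temkin2013 Thm 1.3.3 gives only a finite Zariski COVER by inseparably uniformized pieces — patching them into ONE alteration is unsolved; a 4-fold with no p.i. regular alteration kills this route and pAlteration/WildQuotients together.
sources: Temkin2013, AbramovichOort2000, DeJong1997, Temkin2017
PIAlt_p: every integral separated finite-type scheme over a field of char p admits a purely
inseparable regular alteration (Temkin2013 Conjecture 1.3.1 = Abramovich-Oort 2.9). Known locally
along every valuation: Temkin2013 Thm 1.3.2; known with p-power (not purely inseparable) degree: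
Temkin2017 Thm 1.2.5. -/
@[route_item "route-ResolutionOfSingularities-RadicialJung", crux]
def Pialt : Prop :=
  ∀ p : ℕ, p.Prime → ∀ (k : Type) [Field k] [CharP k p] (X : AlgebraicGeometry.Scheme.{0}) (f : X ⟶ AlgebraicGeometry.Spec (.of k)), AlgebraicGeometry.IsSeparated f → AlgebraicGeometry.LocallyOfFiniteType f → AlgebraicGeometry.QuasiCompact f → AlgebraicGeometry.IsIntegral X → ∃ (X' : AlgebraicGeometry.Scheme.{0}) (g : X' ⟶ X), AlgebraicGeometry.IsProper g ∧ AlgebraicGeometry.IsIntegral X' ∧ Literature.AlgebraicGeometry.Resolution.Scheme.IsRegular X' ∧ Function.Surjective g.base ∧ ∃ U : X.Opens, Dense (U : Set X) ∧ AlgebraicGeometry.IsFinite (AlgebraicGeometry.morphismRestrict g U) ∧ AlgebraicGeometry.UniversallyInjective (AlgebraicGeometry.morphismRestrict g U)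

/-- item stmt-ResolutionOfSingularities-15883 · crux · rank 4 · closed · proved by Summit.ResolutionOfSingularities.ResolutionOfSingularities.Theorems.cleanModelsSuffice_proof (prover) · by planner
why it might fail: Open content = CleanResolves: the pointwise toric charts of a log-clean V need not glue to ONE Zariski log structure on V^L (a ramified divisor can cross a clean point off its toric boundary: z²=x³ at t²=x), so Kato's global fan may not exist; only as typed otherwise (frame proved, probe rc 0).
sources: Kato1994, Niziol2006, BerghRydh2019, Giraud1983Jung, Liu2002, Temkin2013 (arXiv:0804.1554v3 Rem 1.3.5 (ii))
[crux] LOG-CLEAN MODELS SUFFICE, per prime and summit-concluding (NEW rev 2, glue repair; the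
consumed crux, replacing CleanResolves as a `closes` hypothesis): for every prime p, if every
integral separated finite-type scheme over every field of characteristic p admits a regular purely
inseparable alteration (PIAlt_p — the body of Pialt at p, verbatim) and every purely inseparable
degree-p extension L/K(W) of every regular integral separated finite-type W/k with char k = p has a
proper birational REGULAR model V → W that is pointwise log-clean (CleanModels_p — the body of
CleanModels at p, verbatim), then ResolutionInChar p: every reduced separated scheme of finite type
over every field of characteristic p has a resolution. Proof plan: (1) CleanResolves (support since
rev 2; the ONLY unproved content): the log-clean model resolves the normalisation of W in L —
toroidal-type points give Kato-log-regular charts Spec O_{V,v} ⊗_{Z[P]} Z[P^sat], P = ⟨e_0..e_m | p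
e_0 = Σ a_i e_i⟩, regular-type points are regular; Kato1994 (10.4) / Niziol2006 5.8 + gluing of the
toric resolutions; transport along V^L → W^L; (2) hence PicoverDegP_p (pure logic from CleanModels_p
+ CleanResolves); (3) pAlt -/
@[route_item "route-ResolutionOfSingularities-RadicialJung", crux (bottleneck := idea) (source := "director HOURLY-RESOLUTION l.1136, 2026-09-01")]
def CleanModelsSuffice : Prop :=
  ∀ p : ℕ, p.Prime → (∀ (k : Type) [Field k] [CharP k p] (X : AlgebraicGeometry.Scheme.{0}) (f : X ⟶ AlgebraicGeometry.Spec (.of k)), AlgebraicGeometry.IsSeparated f → AlgebraicGeometry.LocallyOfFiniteType f → AlgebraicGeometry.QuasiCompact f → AlgebraicGeometry.IsIntegral X → ∃ (X' : AlgebraicGeometry.Scheme.{0}) (g : X' ⟶ X), AlgebraicGeometry.IsProper g ∧ AlgebraicGeometry.IsIntegral X' ∧ Literature.AlgebraicGeometry.Resolution.Scheme.IsRegular X' ∧ Function.Surjective g.base ∧ ∃ U : X.Opens, Dense (U : Set X) ∧ AlgebraicGeometry.IsFinite (AlgebraicGeometry.morphismRestrict g U) ∧ AlgebraicGeometry.UniversallyInjective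 (AlgebraicGeometry.morphismRestrict g U)) → (∀ (k : Type) [Field k] [CharP k p] (W : AlgebraicGeometry.Scheme.{0}) [AlgebraicGeometry.IsIntegral W] (f : W ⟶ AlgebraicGeometry.Spec (.of k)) (L : Type) [Field L] [Algebra W.functionField L], AlgebraicGeometry.IsSeparated f → AlgebraicGeometry.LocallyOfFiniteType f → AlgebraicGeometry.QuasiCompact f → Literature.AlgebraicGeometry.Resolution.Scheme.IsRegular W → IsPurelyInseparable W.functionField L → Module.finrank W.functionField L = p → ∃ (V : AlgebraicGeometry.Scheme.{0}) (π : V ⟶ W) (_ : AlgebraicGeometry.IsIntegral V) (_ : AlgebraicGeometry.IsDominant π), AlgebraicGeometry.IsProper π ∧ Literature.AlgebraicGeometry.Resolution.IsBirational π ∧ Literature.AlgebraicGeometry.Resolution.Scheme.IsRegular V ∧ (∀ v : V, (∃ (y : L) (g : W.functionField), y ∉ Set.range (algebraMap W.functionField L) ∧ algebraMap W.functionField L g = y ^ p ∧ ((∃ (d m : ℕ) (hmd : m ≤ d) (t : Fin d → V.presheaf.stalk v) (a : Fin m → ℕ), Ideal.span (Set.range t) = IsLocalRing.maximalIdeal (V.presheaf.stalk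 v) ∧ ringKrullDim (V.presheaf.stalk v) = (d : WithBot ℕ∞) ∧ 0 < m ∧ (∀ i, ¬ p ∣ a i) ∧ Literature.AlgebraicGeometry.Motives.RatFn.functionFieldMap π g = ∏ i : Fin m, (algebraMap (V.presheaf.stalk v) V.functionField (t (Fin.castLE hmd i))) ^ (a i)) ∨ (∃ u₀ : V.presheaf.stalk v, IsUnit u₀ ∧ Literature.AlgebraicGeometry.Motives.RatFn.functionFieldMap π g = algebraMap (V.presheaf.stalk v) V.functionField u₀ ∧ ((∀ c : V.presheaf.stalk v, u₀ - c ^ p ∉ IsLocalRing.maximalIdeal (V.presheaf.stalk v)) ∨ (∃ c : V.presheaf.stalk v, u₀ - c ^ p ∈ IsLocalRing.maximalIdeal (V.presheaf.stalk v) ∧ u₀ - c ^ p ∉ IsLocalRing.maximalIdeal (V.presheaf.stalk v) ^ 2))))))) → Literature.AlgebraicGeometry.Resolution.ResolutionInChar.{0} p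

-- `CleanModelsSuffice` holds: proved by `Summit.ResolutionOfSingularities.ResolutionOfSingularities.Theorems.cleanModelsSuffice_proof` (its module imports this route file, so no `_holds` link can be stated here).

-- earlier CleanResolves (stmt-ResolutionOfSingularities-15918, replaced 2026-08-16T16:30:56Z -> stmt-ResolutionOfSingularities-16286): retired by None — ∀ p : ℕ, p.Prime → ∀ (k : Type) [Field k] [CharP k p] (W : AlgebraicGeometry.Scheme.{0}) [AlgebraicGeometry.IsIntegral W] (f : W ⟶ AlgebraicGeometry.Spec (.of k)) (L : Type) [Field L] [Algebra W.functionField L], AlgebraicGeometry.IsSeparated f → Al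
/-- item stmt-ResolutionOfSingularities-16286 · support · rank 4 · closed · proved by Summit.ResolutionOfSingularities.ResolutionOfSingularities.Theorems.cleanResolves_proof (prover) · by planner
why it might fail: the pointwise toric charts need not assemble into ONE Zariski log structure on V^L (a ramified divisor can cross a clean point off its toric boundary: z²=x³ at t²=x), so Kato's global fan may not exist; gluing local toric resolutions needs a canonical subdivision or destackification.
sources: Kato1994, Niziol2006, BerghRydh2019, Giraud1983Jung, Liu2002
[crux] A LOG-CLEAN MODEL RESOLVES THE RESIDUE: with W, L as above and (V, π) as produced by
CleanModels (V integral regular, π proper birational dominant, pointwise log-clean), the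
normalisation of W in L has a resolution. RESTATED rev 1 (cone repair) with
`Literature…normalizationIn W L` UNFOLDED to Mathlib — the relative normalisation `(Spec.map (K(W) →
L) ≫ W.fromSpecStalk (genericPoint W)).normalization` of Spec L → W — definitionally the rev-0
statement (Iff.rfl, probe/ProbeFrame2.lean), so that the route file no longer imports
NormalizationInExtension (whose cone carries DeJong1996Projective and AbramovichOortConjecture);
provers import NormalizationInExtension in their Theorems file and `show … normalizationIn W L` to
use its API (isFinite_normalizationInι, isAlteration_normalizationInι). Plan: at a toroidal-type
point V^L is Zariski-locally Spec of O_{V,v} ⊗_{Z[P]} Z[P^sat], P = ⟨e_0..e_m | p e_0 = Σ a_i e_i⟩,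
log-regular in Kato's sense; at a regular-type point V^L is regular; resolve by
Kato1994_logRegular_hasResolution / canonical toric subdivision glued along strata, then transport
along V^L → W^L (proper birational). [deps: CleanModels] [difficulty: L] -/
@[route_item "route-ResolutionOfSingularities-RadicialJung"]
def CleanResolves : Prop :=
  ∀ p : ℕ, p.Prime → ∀ (k : Type) [Field k] [CharP k p] (W : AlgebraicGeometry.Scheme.{0}) [AlgebraicGeometry.IsIntegral W] (f : W ⟶ AlgebraicGeometry.Spec (.of k)) (L : Type) [Field L] [Algebra W.functionField L], AlgebraicGeometry.IsSeparated f → AlgebraicGeometry.LocallyOfFiniteType f → AlgebraicGeometry.QuasiCompact f → Literature.AlgebraicGeometry.Resolution.Scheme.IsRegular W → IsPurelyInseparable W.functionField L → Module.finrank W.functionField L = p → ∀ (V : AlgebraicGeometry.Scheme.{0}) (π : V ⟶ W) [AlgebraicGeometry.IsIntegral V] [AlgebraicGeometry.IsDominant π], (AlgebraicGeometry.IsProper π ∧ Literature.AlgebraicGeometry.Resolution.IsBirational π ∧ Literature.AlgebraicGeometry.Resolution.Scheme.IsRegular V ∧ (∀ v : V, (∃ (y : L) (g : W.functionField), y ∉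 Set.range (algebraMap W.functionField L) ∧ algebraMap W.functionField L g = y ^ p ∧ ((∃ (d m : ℕ) (hmd : m ≤ d) (t : Fin d → V.presheaf.stalk v) (a : Fin m → ℕ), Ideal.span (Set.range t) = IsLocalRing.maximalIdeal (V.presheaf.stalk v) ∧ ringKrullDim (V.presheaf.stalk v) = (d : WithBot ℕ∞) ∧ 0 < m ∧ (∀ i, ¬ p ∣ a i) ∧ Literature.AlgebraicGeometry.Motives.RatFn.functionFieldMap π g = ∏ i : Fin m, (algebraMap (V.presheaf.stalk v) V.functionField (t (Fin.castLE hmd i))) ^ (a i)) ∨ (∃ u₀ : V.presheaf.stalk v, IsUnit u₀ ∧ Literature.AlgebraicGeometry.Motives.RatFn.functionFieldMap π g = algebraMap (V.presheaf.stalk v) V.functionField u₀ ∧ ((∀ c : V.presheaf.stalk v, u₀ - c ^ p ∉ IsLocalRing.maximalIdeal (V.presheaf.stalk v)) ∨ (∃ c : V.presheaf.stalk v, u₀ - c ^ p ∈ IsLocalRing.maximalIdeal (V.presheaf.stalk v) ∧ u₀ - c ^ p ∉ IsLocalRing.maximalIdeal (V.presheaf.stalk v) ^ 2))))))) → Literature.AlgebraicGeometry.Resolution.Scheme.HasResolution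 ((CategoryTheory.CategoryStruct.comp (AlgebraicGeometry.Spec.map (CommRingCat.ofHom (algebraMap W.functionField L) : W.functionField ⟶ CommRingCat.of L)) (W.fromSpecStalk (genericPoint W))).normalization)

-- `CleanResolves` holds: proved by `Summit.ResolutionOfSingularities.ResolutionOfSingularities.Theorems.cleanResolves_proof` (its module imports this route file, so no `_holds` link can be stated here).

/-- item stmt-ResolutionOfSingularities-18006 · support · rank 9 · open · by planner
why it might fail: dim-4 centre + DEFECT valuation (rank 1, rat. rank 1): the order of x mod p-th powers (Giraud's residual order, height one) can jump at kangaroo points when the centre is blown up; no bound on such jumps is known in dim 4 even along one valuation (CP2009's dim-3 proof is a 150-pp case analysis).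
sources: Giraud1983, Giraud1983Jung, CossartPiltant2008, CossartPiltant2009, KnafKuhlmann2005, NovacoskiSpivakovsky2014 = arXiv:1204.4751 (Defs 2.8-2.20 local blow-ups; Thm 1.1 rank-one reduction)
[support] FIRST LEMMA OF THE ATTACK ON CleanModels (judge what_would_move_it, 2026-08-17: 'a stated
and stubbed first lemma for cleaning dg on a regular 4-fold along ONE valuation (local version)').
LOG-CLEANING ALONG ONE VALUATION, BASE DIMENSION ≤ 4: k a field of char p; K/k a function field
given with an affine model A₀ (f.g. k-subalgebra, Frac A₀ = K); O a valuation ring of K containing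
A₀ (a valuation of K(W) centred on W = Spec A₀) whose centre R₀ = (A₀)_{m_O ∩ A₀} = locAtCentre A₀ O
(Literature LocalBlowup.lean) is REGULAR of dimension ≤ 4; g ∈ K ∖ K^p the radicial datum (L =
K(g^{1/p}); dg ≠ 0 is the exact differential to clean). CLAIM: some f.g. A with A₀ ⊆ A ⊆ O —
equivalently a finite tower of LOCAL BLOW-UPS of R₀ along O (IsLocalBlowup, lu_tower_iff_fg) — has
REGULAR centre R = locAtCentre A O at which a non-trivial representative x = Σ_{j<p} c_j^p g^j of
the K^p-line of g is LOOSELY LOG-CLEAN: x = u·∏_{i<m} t_i^{a_i} with (t_1..t_d) a regular system of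
parameters of R (d = dim R), u ∈ R^×, m ≥ 1, p ∤ a_i (toroidal type: dlog x spans a saturated line
of Ω¹_R(log ∏t_i), the normalisation in L is Kato-toroidal), or x = u ∈ R^× residually not a p-th
power (regular type i), -/
@[route_item "route-ResolutionOfSingularities-RadicialJung", crux]
def CleanAlongValuation4 : Prop :=
  ∀ p : ℕ, p.Prime → ∀ (k K : Type) [Field k] [CharP k p] [Field K] [Algebra k K] (O : ValuationSubring K) (A₀ : Subalgebra k K) (h₀ : A₀.toSubring ≤ O.toSubring) (g : K), A₀.FG → IsFractionRing A₀ K → (∀ c : K, c ^ p ≠ g) → IsRegularLocalRing (Literature.AlgebraicGeometry.Resolution.locAtCentre A₀.toSubring O) → ringKrullDim (Literature.AlgebraicGeometry.Resolution.locAtCentre A₀.toSubring O) ≤ ((4 : ℕ) : WithBot ℕ∞) → ∃ (A : Subalgebra k K) (_h : A.toSubring ≤ O.toSubring) (_ : IsRegularLocalRing (Literature.AlgebraicGeometry.Resolution.locAtCentre A.toSubring O)), A₀ ≤ A ∧ A.FG ∧ ∃ c : Fin p → K, (∃ j : Fin p, (j : ℕ) ≠ 0 ∧ c j ≠ 0)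 ∧ ((∃ (d m : ℕ) (hmd : m ≤ d) (t : Fin d → Literature.AlgebraicGeometry.Resolution.locAtCentre A.toSubring O) (a : Fin m → ℕ) (u : Literature.AlgebraicGeometry.Resolution.locAtCentre A.toSubring O), IsUnit u ∧ Ideal.span (Set.range t) = IsLocalRing.maximalIdeal (Literature.AlgebraicGeometry.Resolution.locAtCentre A.toSubring O) ∧ ringKrullDim (Literature.AlgebraicGeometry.Resolution.locAtCentre A.toSubring O) = (d : WithBot ℕ∞) ∧ 0 < m ∧ (∀ i, ¬ p ∣ a i) ∧ (∑ j : Fin p, c j ^ p * g ^ (j : ℕ)) = (u : K) * ∏ i : Fin m, ((t (Fin.castLE hmd i) : Literature.AlgebraicGeometry.Resolution.locAtCentre A.toSubring O) : K) ^ (a i)) ∨ (∃ u : Literature.AlgebraicGeometry.Resolution.locAtCentre A.toSubring O, IsUnit u ∧ (∑ j : Fin p, c j ^ p * g ^ (j : ℕ)) = (u : K) ∧ ∀ c' : Literature.AlgebraicGeometry.Resolution.locAtCentre A.toSubring O, u - c' ^ p ∉ IsLocalRing.maximalIdeal (Literature.AlgebraicGeometry.Resolution.locAtCentre A.toSubring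 O)) ∨ (∃ s c' : Literature.AlgebraicGeometry.Resolution.locAtCentre A.toSubring O, (∑ j : Fin p, c j ^ p * g ^ (j : ℕ)) = (s : K) ∧ s - c' ^ p ∈ IsLocalRing.maximalIdeal (Literature.AlgebraicGeometry.Resolution.locAtCentre A.toSubring O) ∧ s - c' ^ p ∉ IsLocalRing.maximalIdeal (Literature.AlgebraicGeometry.Resolution.locAtCentre A.toSubring O) ^ 2))

-- earlier Assembly (stmt-ResolutionOfSingularities-15919, replaced 2026-08-16T16:30:56Z -> stmt-ResolutionOfSingularities-16287): retired by None — CleanModels → CleanResolves → Pialt → _root_.ResolutionOfSingularities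
-- earlier Assembly (stmt-ResolutionOfSingularities-16287, replaced 2026-08-16T16:53:15Z -> stmt-ResolutionOfSingularities-15905): retired by None — CleanModels → CleanResolves → Pialt → PialtPicoverDegPFrame → _root_.ResolutionOfSingularities
/-- item stmt-ResolutionOfSingularities-15905 · assembly · rank 1 · closed · proved by Summit.ResolutionOfSingularities.ResolutionOfSingularities.Theorems.radicialJung_assembly_proof @ 4c65afe434dc (prover) · by planner
sources: Temkin2013, Giraud1983Jung
[assembly] CleanModels → Pialt → CleanModelsSuffice → ResolutionOfSingularities (rev 2 chain = the
type of the deciding theorem `closes`, closable at once by pure logic: `fun hC hP hS =>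
ResolutionOfSingularities_iff.mpr fun p hp => hS p hp (hP p hp) (hC p hp)`). -/
@[route_item "route-ResolutionOfSingularities-RadicialJung"]
def Assembly : Prop :=
  CleanModels → Pialt → CleanModelsSuffice → _root_.ResolutionOfSingularities

-- `Assembly` holds: proved by `Summit.ResolutionOfSingularities.ResolutionOfSingularities.Theorems.radicialJung_assembly_proof` @ 4c65afe434dc (its module imports this route file, so no `_holds` link can be stated here).

/-! D-0027 §2.1 — DECIDING THEOREM (planner-authored via `route open/edit --closes-file`; by planner-rrepair-ResolutionOfSingularities-Radi-32f2f141-g2-0 2026-08-16T16:52:15Z):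
its hypotheses are this route's items and its conclusion the sub-problem Statement (glue_lint), and it elaborates with this file. -/

/-- D-0027 §2.1 deciding theorem of route RadicialJung (rev 2, glue repair): the three CRUXES imply the summit
statement `ResolutionOfSingularities` (by name) by pure logic — fix a prime `p`; `CleanModelsSuffice p hp` consumes
`Pialt` and `CleanModels` specialised at `p` (its two antecedents are their bodies verbatim) and yields
`ResolutionInChar p`; `ResolutionOfSingularities_iff` (Statement file) folds the primes back into the summit.
No Theorems module and no fact-bearing Literature module is imported by the route file: pAlteration's PROVED
per-prime frame (`Theorems.palterationThesisAt_iff_resolutionInChar`, the degree-`p` tower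
`Theorems.Picover.OfDegP.hasResolution_normalizationIn_of_finrank_eq_pow`) and the open content `CleanResolves`
(support) live INSIDE the crux `CleanModelsSuffice`, whose prover imports them in a Theorems file
(planner probe: `CleanResolves → CleanModelsSuffice` from those theorems alone, lean check rc 0, standard axioms). -/
@[closes "route-ResolutionOfSingularities-RadicialJung"] theorem closes (hC : CleanModels) (hP : Pialt) (hS : CleanModelsSuffice) :
    _root_.ResolutionOfSingularities :=
  _root_.ResolutionOfSingularities_iff.mpr fun p hp => hS p hp (hP p hp) (hC p hp)

end Summit.ResolutionOfSingularities.ResolutionOfSingularities.Theses.RadicialJung
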